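/-
Copyright: cell pub-balaban-gaps (YM BLITZ Y1, track G1), seat g1-p2 GEN 4 (unit `pub-balaban-gaps-g1-p2`).  Row (D4) NODE O,
OBJECT ∕ MECHANISM level: the PRODUCT step of the walk-expansion calculus at the level of the FULL `JointWalkExpansion` shape
(σ-structure + termwise analyticity + reduced-rate window), BY NAME over ne5's entry-level `Spine.NE5.ProductWalks` (T9a, p352439 ✓)
and the tree's [B9] Sect. D walk algebra `B9SectDWalk`.  HONEST FRAMING: bookkeeping over landed hypothesis SHAPES; nothing of
Bałaban's constructed or asserted; (D4) NOT discharged (instance 0∕1); NOT BetaPertH, NOT continuum, NOT Clay.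
-/
import Summits.QuantumFields.BalabanUV.T4Continuum.Spine.NE5.ProductWalks

/-!
# `Gaps.D4WalkProduct` — the product of two JOINT walk expansions is a joint walk expansion (cell pub-balaban-gaps, seat g1-p2 gen 4)

HONEST DEPENDENCY (cell pub-balaban, verbatim): continuum YM on T⁴ ⇐ BetaPertH ∧ nine spine estimates (0/9 proved);
BetaPertH ⇐ (D1) ∧ (D4) ∧ CAP+tail.

[B9] p. 422 (verbatim): *"Of course Theorem 3.10 holds also because we replace each operator in (3.130) by its random walk
expansion."*  ne5's `Spine.NE5.ProductWalks.walkMajorants_mul` (p352439 ✓) kernel-checks the ENTRY-LEVEL half of that sentence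
for a product `K₁K₂` of two walk-expanded kernel families: `HasSum` by the Cauchy product, the per-term bound (3.92)→(3.94) with
the concatenated walk distance (3.93) `D₁ □ D₂` (the LEFT factor pays the row sum (2.61) from its rate excess), and the partial-sum
majorants `MajSumLe` WITHOUT walk counting — i.e. the covariance-slot triple `WalkMajorants`.  THIS FILE adds the four fields by
which the (D4) NODE-O object `JointWalkExpansion` (`B13JointWalkExpansion`, p349529 ✓) exceeds that triple, so that the Γ-kernel
and precision slots of `B13TermWalkData.TermWalkData` are closed under products too:
* `termAnalytic` — a product entry `Σ_k T₁(i,k)T₂(k,j)` is a FINITE sum of products of functions complex-differentiable on the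
  ball ([II] p. 15; [B9] Thm 3.10: *"A term … depends on configuration U restricted to X̃₀⁵ ∪ … ∪ X̃ₙ⁵"* — analyticity is termwise);
* `indep` — a product of two σ-free terms is σ-free (the s-monomials multiply: [II] (1.11), `m(ω₁ω₂) = m(ω₁) + m(ω₂)`);
* `through` — if one factor's walk distance passes through `X` so does `D₁ □ D₂` (`B9SectDWalk.through_infConv_left ∕ _right`,
  (3.93) p. 410);
* the REDUCED-RATE WINDOW — the product's partial-sum majorants at the dropped rate `ρ − ε` from the factors' at `ρᵢ − εᵢ`
  (`ProductWalks.majSumLe_mul`), provided the product window sits inside both factors' windows: `ρᵢ − εᵢ ≤ ρ − ε`.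
THEOREMS: `jointWalkExpansion_mul` (left factor pays: `ρ + σ ≤ ρ₁`, `ρ ≤ ρ₂`), `jointWalkExpansion_mul_mirror` (right factor pays),
`domBy_infConv_torus` (the product distance dominates `d₁` again, so products iterate), `through_mono` (σ-regions may be enlarged).
RATE LEDGER (plan-1 §2 note 17 ∕ ne5 (x5)): every product costs ONE row-sum rate `σ` off the paying factor's per-term rate and
keeps a window `ε ≤ min(εᵢ − (ρᵢ − ρ))`; constants multiply: `K̄ = (mc)K̄₁K̄₂c′`, amplitudes `(mc)A₁A₂`.
Value: kernel-checked bookkeeping over landed SHAPES, NOT summit progress; nothing of Bałaban's asserted; words of row (D4) UNCHANGED.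
-/

noncomputable section

namespace Summit.QuantumFields.BalabanUV.Gaps.D4WalkProduct

open Metric Set Finset
open Literature.MathematicalPhysics.QuantumFieldTheory.Balaban1983to89
open Literature.MathematicalPhysics.QuantumFieldTheory.Balaban1983to89.B9SectDWalk
  (Through MajSumLe DomBy infConv le_infConv domBy_infConv through_infConv_left through_infConv_right)
open Literature.MathematicalPhysics.QuantumFieldTheory.Balaban1983to89.B9Thm34Ext (toB6)
open Literature.MathematicalPhysics.QuantumFieldTheory.Balaban1983to89.B9Thm37GlueTorus
  (torusGeom tdist1 tdist1_nonneg hdnn_torusGeom htri_torusGeom)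
open Literature.MathematicalPhysics.QuantumFieldTheory.Balaban1983to89.TreeLengthTorus (TPt)
open Literature.MathematicalPhysics.QuantumFieldTheory.Balaban1983to89.B5TorusCover (UT)
open Literature.MathematicalPhysics.QuantumFieldTheory.Balaban1983to89.B11SectG (RowSum)
open Literature.MathematicalPhysics.QuantumFieldTheory.Balaban1983to89.B13JointWalkExpansion (JointWalkExpansion WalkMajorants)
open Summit.QuantumFields.BalabanUV.T4Continuum.Spine.NE5.ProductWalks
  (walkMajorants_mul walkMajorants_mul_mirror majSumLe_mul)

variable {ν : ℕ} {Nf : Fin ν → ℕ} [∀ i, NeZero (Nf i)]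

/-! ## §1. Two geometric one-liners on the torus geometry of the walk objects -/

/-- **The product distance dominates `d₁` again** ((2.54) on the one-scale torus, `B9SectDWalk.domBy_infConv` with
`htri_torusGeom`): products of walk-expanded families can be iterated. [cite: Balaban1984PropagatorsII, (2.54) p.233; Balaban1985BackgroundPropagators, (3.93) p.410] -/
theorem domBy_infConv_torus {D₁ D₂ : UT Nf → UT Nf → ℝ} (h₁ : DomBy (toB6 (torusGeom Nf 0 0 0) 0 True) D₁)
    (h₂ : DomBy (toB6 (torusGeom Nf 0 0 0) 0 True) D₂) :
    DomBy (toB6 (torusGeom Nf 0 0 0) 0 True) (infConv (g := toB6 (torusGeom Nf 0 0 0) 0 True) D₁ D₂) :=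
  domBy_infConv (htri_torusGeom 0 0 0 0 True) h₁ h₂

omit [∀ i, NeZero (Nf i)] in
/-- Passage through a set is monotone in the set (σ-regions may be enlarged before multiplying families with different
regions). [cite: Balaban1985BackgroundPropagators, (3.93) p.410] -/
theorem through_mono {g : B6.Geometry} {D : g.Site → g.Site → ℝ} {X Y : Set g.Site} (h : Through g D X) (hXY : X ⊆ Y) :
    Through g D Y := fun y y' =>
  let ⟨z, hz, hle⟩ := h y y'; ⟨z, hXY hz, hle⟩

/-! ## §2. The product of two joint walk expansions -/

variable {d N' : ℕ} {p n q : Type} [Fintype n]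
variable {E : Type*} [NormedAddCommGroup E] [NormedSpace ℂ E]
variable {c₀ : B13.Consts} {locp : p → UT Nf} {locn : n → UT Nf} {locq : q → UT Nf}
variable {K₁ : (TPt d N' → ℂ) → E → Matrix p n ℂ} {K₂ : (TPt d N' → ℂ) → E → Matrix n q ℂ}
variable {X : Finset (UT Nf)} {R : ℝ}
variable {W₁ W₂ : Type} {T₁ : W₁ → (TPt d N' → ℂ) → E → Matrix p n ℂ} {T₂ : W₂ → (TPt d N' → ℂ) → E → Matrix n q ℂ}
variable {SX₁ : Set W₁} {SX₂ : Set W₂}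
variable {A₁ : W₁ → ℝ} {A₂ : W₂ → ℝ} {D₁ : W₁ → UT Nf → UT Nf → ℝ} {D₂ : W₂ → UT Nf → UT Nf → ℝ}
variable {ρ₁ ρ₂ ε₁ ε₂ κ₁ κ₂ Kbar₁ Kbar₂ ρ ε κ σ c σ' c' : ℝ} {m : ℕ}

/-- Termwise analyticity of a product: the `(i,j)` entry of `T₁(σ,u)·T₂(σ,u)` is a finite sum of products of functions
complex-differentiable on the ball. [cite: Balaban1988RG2Cluster, p.15; Balaban1985BackgroundPropagators, Thm 3.10 p.416] -/
theorem differentiableOn_mul_entry {M₁ : E → Matrix p n ℂ} {M₂ : E → Matrix n q ℂ} {s : Set E}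
    (h₁ : ∀ i k, DifferentiableOn ℂ (fun u => M₁ u i k) s) (h₂ : ∀ k j, DifferentiableOn ℂ (fun u => M₂ u k j) s)
    (i : p) (j : q) : DifferentiableOn ℂ (fun u => (M₁ u * M₂ u) i j) s := by
  have e : (fun u => (M₁ u * M₂ u) i j) = fun u => ∑ k, M₁ u i k * M₂ u k j := funext fun u => Matrix.mul_apply
  rw [e]
  exact DifferentiableOn.fun_sum fun k _ => (h₁ i k).mul (h₂ k j)

/-- **THE PRODUCT OF TWO JOINT WALK EXPANSIONS IS A JOINT WALK EXPANSION** (left factor pays).  Data: `K₁ = Σ T₁` a joint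
walk expansion (rows `p`, middle index `n`) with per-term rate `ρ₁`, window `ε₁`, torus rate `κ₁`, constant `K̄₁`, its walk
distances dominating `d₁`; `K₂ = Σ T₂` likewise (`n × q`, `ρ₂, ε₂, κ₂, K̄₂`, distances dominating `d₁`); the SAME σ-region `X`
and ball radius `R`; fibre multiplicity `m` of the middle locator; row sums (2.61) at rates `σ` (constant `c ≥ 0`) and `σ′`
(constant `c′`).  Rates: `0 ≤ ρ ≤ ρ₂`, `0 ≤ σ`, `ρ + σ ≤ ρ₁` (the left factor's excess pays the middle sum), the WINDOW
`0 ≤ ε`, `ρ₁ − ε₁ ≤ ρ − ε`, `ρ₂ − ε₂ ≤ ρ − ε`, and `0 ≤ κ ≤ κ₂`, `κ + σ′ ≤ κ₁`.  Conclusion: `K₁K₂ = Σ_{(ω₁,ω₂)} T₁ω₁·T₂ω₂` is a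
`JointWalkExpansion` with σ-carrying sub-family `{ω₁ ∈ SX₁ ∨ ω₂ ∈ SX₂}`, amplitudes `(mc)A₁A₂`, walk distance `D₁ □ D₂`, rate `ρ`,
window `ε`, torus rate `κ`, constant `(mc)K̄₁K̄₂c′`.  The three entry-level fields are ne5's `walkMajorants_mul` ∕ `majSumLe_mul`
BY NAME; `termAnalytic`, `indep`, `through`, `D_nonneg` are the additions. [cite: Balaban1985BackgroundPropagators, (3.92)–(3.94) p.410, (3.107)–(3.108) p.416, p.422; Balaban1988RG2Cluster, (1.11) p.5, p.13, p.15; Balaban1984PropagatorsII, (2.61) p.234] -/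
theorem jointWalkExpansion_mul
    (h₁ : JointWalkExpansion c₀ locp locn K₁ X R ε₁ κ₁ Kbar₁ T₁ SX₁ A₁ D₁ ρ₁)
    (h₂ : JointWalkExpansion c₀ locn locq K₂ X R ε₂ κ₂ Kbar₂ T₂ SX₂ A₂ D₂ ρ₂)
    (hdom₁ : ∀ ω, DomBy (toB6 (torusGeom Nf 0 0 0) 0 True) (D₁ ω))
    (hdom₂ : ∀ ω, DomBy (toB6 (torusGeom Nf 0 0 0) 0 True) (D₂ ω))
    (hfib : ∀ y : UT Nf, (Finset.univ.filter fun k => locn k = y).card ≤ m)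
    (hrow : RowSum (toB6 (torusGeom Nf 0 0 0) 0 True) σ c) (hrow' : RowSum (toB6 (torusGeom Nf 0 0 0) 0 True) σ' c')
    (hρ : 0 ≤ ρ) (hρ₂ : ρ ≤ ρ₂) (hσ : 0 ≤ σ) (hρ₁ : ρ + σ ≤ ρ₁)
    (hε : 0 ≤ ε) (hw₁ : ρ₁ - ε₁ ≤ ρ - ε) (hw₂ : ρ₂ - ε₂ ≤ ρ - ε)
    (hK₁ : 0 ≤ Kbar₁) (hK₂ : 0 ≤ Kbar₂) (hκ : 0 ≤ κ) (hκ₂ : κ ≤ κ₂) (hκ₁ : κ + σ' ≤ κ₁) (hc : 0 ≤ c) :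
    JointWalkExpansion c₀ locp locq (fun σ₀ u => K₁ σ₀ u * K₂ σ₀ u) X R ε κ ((m * c) * Kbar₁ * Kbar₂ * c')
      (fun (ω : W₁ × W₂) σ₀ u => T₁ ω.1 σ₀ u * T₂ ω.2 σ₀ u) {ω | ω.1 ∈ SX₁ ∨ ω.2 ∈ SX₂}
      (fun ω => (m * c) * (A₁ ω.1 * A₂ ω.2))
      (fun ω => infConv (g := toB6 (torusGeom Nf 0 0 0) 0 True) (D₁ ω.1) (D₂ ω.2)) ρ := by
  -- the entry-level triple at the per-term rate `ρ` (factor majorants at their window rates `ρᵢ − εᵢ ≤ ρ`)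
  have hr₁ : ρ₁ - ε₁ ≤ ρ := hw₁.trans (sub_le_self ρ hε)
  have hr₂ : ρ₂ - ε₂ ≤ ρ := hw₂.trans (sub_le_self ρ hε)
  have hW := walkMajorants_mul h₁.hasSum h₂.hasSum h₁.maj h₂.maj h₁.majSum h₂.majSum h₁.A_nonneg h₂.A_nonneg
    h₁.D_nonneg h₂.D_nonneg hdom₁ hfib hrow hrow' hρ hρ₂ hσ hρ₁ hr₁ hr₂ hK₁ hK₂ hκ hκ₂ hκ₁ hc
  exact
  { hasSum := hW.hasSum
    termAnalytic := fun ω σ₀ hσ₀ i j =>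
      differentiableOn_mul_entry (fun i k => h₁.termAnalytic ω.1 σ₀ hσ₀ i k) (fun k j => h₂.termAnalytic ω.2 σ₀ hσ₀ k j) i j
    maj := hW.maj
    majSum := majSumLe_mul (Nf := Nf) (C := m * c) h₁.A_nonneg h₂.A_nonneg h₁.D_nonneg h₂.D_nonneg hw₁ hw₂
      (mul_nonneg (Nat.cast_nonneg m) hc) hK₁ hK₂ hκ hκ₂ hκ₁ hrow' h₁.majSum h₂.majSum
    indep := fun ω hω σ₀ hσ₀ => by
      simp only [Set.mem_setOf_eq, not_or] at hω
      show T₁ ω.1 σ₀ 0 * T₂ ω.2 σ₀ 0 = T₁ ω.1 0 0 * T₂ ω.2 0 0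
      rw [h₁.indep ω.1 hω.1 σ₀ hσ₀, h₂.indep ω.2 hω.2 σ₀ hσ₀]
    through := fun ω hω => by
      rcases hω with h | h
      · exact through_infConv_left (htri_torusGeom 0 0 0 0 True) (h₁.through ω.1 h) (hdom₂ ω.2)
      · exact through_infConv_right (htri_torusGeom 0 0 0 0 True) (hdom₁ ω.1) (h₂.through ω.2 h)
    A_nonneg := hW.A_nonneg
    D_nonneg := fun ω a b => le_infConv fun y => add_nonneg (h₁.D_nonneg ω.1 a y) (h₂.D_nonneg ω.2 y b) }

/-- **The product, mirror form** (the RIGHT factor pays: `0 ≤ ρ ≤ ρ₁`, `ρ + σ ≤ ρ₂`; everything else as in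
`jointWalkExpansion_mul`) — over ne5's `walkMajorants_mul_mirror`. [cite: Balaban1985BackgroundPropagators, (3.92)–(3.94) p.410, p.422; Balaban1988RG2Cluster, (1.11) p.5, p.15] -/
theorem jointWalkExpansion_mul_mirror
    (h₁ : JointWalkExpansion c₀ locp locn K₁ X R ε₁ κ₁ Kbar₁ T₁ SX₁ A₁ D₁ ρ₁)
    (h₂ : JointWalkExpansion c₀ locn locq K₂ X R ε₂ κ₂ Kbar₂ T₂ SX₂ A₂ D₂ ρ₂)
    (hdom₁ : ∀ ω, DomBy (toB6 (torusGeom Nf 0 0 0) 0 True) (D₁ ω))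
    (hdom₂ : ∀ ω, DomBy (toB6 (torusGeom Nf 0 0 0) 0 True) (D₂ ω))
    (hfib : ∀ y : UT Nf, (Finset.univ.filter fun k => locn k = y).card ≤ m)
    (hrow : RowSum (toB6 (torusGeom Nf 0 0 0) 0 True) σ c) (hrow' : RowSum (toB6 (torusGeom Nf 0 0 0) 0 True) σ' c')
    (hρ : 0 ≤ ρ) (hρ₁ : ρ ≤ ρ₁) (hσ : 0 ≤ σ) (hρ₂ : ρ + σ ≤ ρ₂)
    (hε : 0 ≤ ε) (hw₁ : ρ₁ - ε₁ ≤ ρ - ε) (hw₂ : ρ₂ - ε₂ ≤ ρ - ε)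
    (hK₁ : 0 ≤ Kbar₁) (hK₂ : 0 ≤ Kbar₂) (hκ : 0 ≤ κ) (hκ₂ : κ ≤ κ₂) (hκ₁ : κ + σ' ≤ κ₁) (hc : 0 ≤ c) :
    JointWalkExpansion c₀ locp locq (fun σ₀ u => K₁ σ₀ u * K₂ σ₀ u) X R ε κ ((m * c) * Kbar₁ * Kbar₂ * c')
      (fun (ω : W₁ × W₂) σ₀ u => T₁ ω.1 σ₀ u * T₂ ω.2 σ₀ u) {ω | ω.1 ∈ SX₁ ∨ ω.2 ∈ SX₂}
      (fun ω => (m * c) * (A₁ ω.1 * A₂ ω.2))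
      (fun ω => infConv (g := toB6 (torusGeom Nf 0 0 0) 0 True) (D₁ ω.1) (D₂ ω.2)) ρ := by
  have hr₁ : ρ₁ - ε₁ ≤ ρ := hw₁.trans (sub_le_self ρ hε)
  have hr₂ : ρ₂ - ε₂ ≤ ρ := hw₂.trans (sub_le_self ρ hε)
  have hW := walkMajorants_mul_mirror h₁.hasSum h₂.hasSum h₁.maj h₂.maj h₁.majSum h₂.majSum h₁.A_nonneg h₂.A_nonneg
    h₁.D_nonneg h₂.D_nonneg hdom₂ hfib hrow hrow' hρ hρ₁ hσ hρ₂ hr₁ hr₂ hK₁ hK₂ hκ hκ₂ hκ₁ hc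
  exact
  { hasSum := hW.hasSum
    termAnalytic := fun ω σ₀ hσ₀ i j =>
      differentiableOn_mul_entry (fun i k => h₁.termAnalytic ω.1 σ₀ hσ₀ i k) (fun k j => h₂.termAnalytic ω.2 σ₀ hσ₀ k j) i j
    maj := hW.maj
    majSum := majSumLe_mul (Nf := Nf) (C := m * c) h₁.A_nonneg h₂.A_nonneg h₁.D_nonneg h₂.D_nonneg hw₁ hw₂
      (mul_nonneg (Nat.cast_nonneg m) hc) hK₁ hK₂ hκ hκ₂ hκ₁ hrow' h₁.majSum h₂.majSum
    indep := fun ω hω σ₀ hσ₀ => by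
      simp only [Set.mem_setOf_eq, not_or] at hω
      show T₁ ω.1 σ₀ 0 * T₂ ω.2 σ₀ 0 = T₁ ω.1 0 0 * T₂ ω.2 0 0
      rw [h₁.indep ω.1 hω.1 σ₀ hσ₀, h₂.indep ω.2 hω.2 σ₀ hσ₀]
    through := fun ω hω => by
      rcases hω with h | h
      · exact through_infConv_left (htri_torusGeom 0 0 0 0 True) (h₁.through ω.1 h) (hdom₂ ω.2)
      · exact through_infConv_right (htri_torusGeom 0 0 0 0 True) (hdom₁ ω.1) (h₂.through ω.2 h)
    A_nonneg := hW.A_nonneg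
    D_nonneg := fun ω a b => le_infConv fun y => add_nonneg (h₁.D_nonneg ω.1 a y) (h₂.D_nonneg ω.2 y b) }

/-- **Domination for the product's walk distances** (so that `jointWalkExpansion_mul` can be applied to the product again:
its `hdom` input). [cite: Balaban1984PropagatorsII, (2.54) p.233; Balaban1985BackgroundPropagators, (3.93) p.410] -/
theorem domBy_mul (hdom₁ : ∀ ω, DomBy (toB6 (torusGeom Nf 0 0 0) 0 True) (D₁ ω))
    (hdom₂ : ∀ ω, DomBy (toB6 (torusGeom Nf 0 0 0) 0 True) (D₂ ω)) (ω : W₁ × W₂) :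
    DomBy (toB6 (torusGeom Nf 0 0 0) 0 True) (infConv (g := toB6 (torusGeom Nf 0 0 0) 0 True) (D₁ ω.1) (D₂ ω.2)) :=
  domBy_infConv_torus (hdom₁ ω.1) (hdom₂ ω.2)

/-! ## §3. The SAME-WINDOW corollary (the form a uniform package uses: both factors at `(ρ₀, ε₀)`, product at
`(ρ₀ − σ, ε₀ − σ)` — ONE row-sum rate off the per-term rate AND off the window per product, plan-1 §2 note 17) -/

/-- **Same-window product**: both factors with per-term rate `ρ₀`, window `ε₀`, torus rate `κ₀`; row sums at ONE rate `σ`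
(`0 ≤ σ ≤ ε₀`, `σ ≤ ρ₀`, `σ ≤ κ₀`, constant `c ≥ 0`).  Then the product is a joint walk expansion at per-term rate `ρ₀ − σ`,
window `ε₀ − σ`, torus rate `κ₀ − σ`, constant `(mc)K̄₁K̄₂c`.  [cite: Balaban1985BackgroundPropagators, (3.92)–(3.94) p.410, p.416, p.422; Balaban1984PropagatorsII, (2.61) p.234] -/
theorem jointWalkExpansion_mul_sameWindow {ρ₀ ε₀ κ₀ : ℝ}
    (h₁ : JointWalkExpansion c₀ locp locn K₁ X R ε₀ κ₀ Kbar₁ T₁ SX₁ A₁ D₁ ρ₀)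
    (h₂ : JointWalkExpansion c₀ locn locq K₂ X R ε₀ κ₀ Kbar₂ T₂ SX₂ A₂ D₂ ρ₀)
    (hdom₁ : ∀ ω, DomBy (toB6 (torusGeom Nf 0 0 0) 0 True) (D₁ ω))
    (hdom₂ : ∀ ω, DomBy (toB6 (torusGeom Nf 0 0 0) 0 True) (D₂ ω))
    (hfib : ∀ y : UT Nf, (Finset.univ.filter fun k => locn k = y).card ≤ m)
    (hrow : RowSum (toB6 (torusGeom Nf 0 0 0) 0 True) σ c)
    (hσ : 0 ≤ σ) (hσε : σ ≤ ε₀) (hσρ : σ ≤ ρ₀) (hσκ : σ ≤ κ₀) (hK₁ : 0 ≤ Kbar₁) (hK₂ : 0 ≤ Kbar₂) (hc : 0 ≤ c) :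
    JointWalkExpansion c₀ locp locq (fun σ₀ u => K₁ σ₀ u * K₂ σ₀ u) X R (ε₀ - σ) (κ₀ - σ) ((m * c) * Kbar₁ * Kbar₂ * c)
      (fun (ω : W₁ × W₂) σ₀ u => T₁ ω.1 σ₀ u * T₂ ω.2 σ₀ u) {ω | ω.1 ∈ SX₁ ∨ ω.2 ∈ SX₂}
      (fun ω => (m * c) * (A₁ ω.1 * A₂ ω.2))
      (fun ω => infConv (g := toB6 (torusGeom Nf 0 0 0) 0 True) (D₁ ω.1) (D₂ ω.2)) (ρ₀ - σ) :=
  jointWalkExpansion_mul h₁ h₂ hdom₁ hdom₂ hfib hrow hrow (sub_nonneg.2 hσρ) (sub_le_self ρ₀ hσ) hσ (by linarith)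
    (sub_nonneg.2 hσε) (by linarith) (by linarith) hK₁ hK₂ (sub_nonneg.2 hσκ) (sub_le_self κ₀ hσ) (by linarith) hc

end Summit.QuantumFields.BalabanUV.Gaps.D4WalkProduct

end
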